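import Literature.AlgebraicGeometry.Hu2025.Statements.S04ModelV.R103cClaims
import Literature.AlgebraicGeometry.Hu2025.Proofs.S04ModelV.Lem45
import HarnessLib

/-!
# Hu 2025 §4.2.1, Lem. 4.8 ‹chunk Lem. 4.7› — `Lem4_8` (row 103, file b, [OPT]) DISCHARGED UNDER EXPLICIT PLATFORM
# HYPOTHESES (`Lem4_8_of_platform`) = the OURS sibling `Lem4_8_ours` of file c DISCHARGED (`Lem4_8_ours_holds`, every `k`);
# file `Proofs/S04ModelV/Lem48Platform.lean`, typer of record res-type-042

**HONEST FRAMING (D-0012/D-0089).** A theorem about OUR generic rendering `S04ModelV.Lem4_8`: it holds for every nontrivial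
commutative ring `k`, all index data and every `Φ`, PROVIDED the chart monomials satisfy what the printed proof uses —
`hhead`: the leading term of `F` is a term of `F`; (H1) for rank-one `F` the chart monomial of the leading term is a single
ϖ-variable `x_{u_F}` (on the platform `x̄_{s_F} = x_abc`); (H2) `u_F` occurs in the chart monomial of no other term («since
`x_(123,abc)` is the unique ϱ-variable such that its `φ`-image is dividable by `x_abc`», chunk p0022 l.92–93 / PDF p.48
L021–L022). Without (H1)/(H2) the generic statement fails (`OptLemmasGeneric.not_Lem4_8`). Whether the platform data of rows
101/102/105 satisfy (H1)/(H2) is an instance-level check, not made here. The preprint [Hu2025] (arXiv:2507.21400v1) stays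
«under review»; nothing of it is asserted; AI proof is weaker than expert review.

Proof = the printed one (p0022 l.87–106): `φ̂(e)(u_F) = e(x_{u_F}) + e(x_h)` (`phiHat_apply_of_unique`), so `φ(m) = φ(m′)` and
«no common factor» give the two divisibility transfers; block-`F` homogeneity produces a second ϱ-variable `x_{t′}` of the block
in the other monomial; Def. 4.7 with the ℘-binomial `x̄_{t′} x_h − x̄_h x_{t′}` and the congruence
`(m − m′) − x_h (n − n′) = ± x^r · (x̄_{t′} x_h − x̄_h x_{t′}) ∈ (B^℘_[k])`.
-/

noncomputable section

namespace Literature.AlgebraicGeometry.Hu2025.Statements.S04ModelV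

open MvPolynomial

universe u v w x

variable {k : Type u} [CommRing k] {σ : Type v} {T : Type w} {𝔗 : Type x}

/-! ## Lem. 4.8 under PLATFORM HYPOTHESES -/

/-- The exponent map `φ̂` of `φ` evaluated at a ϖ-variable `u` that occurs in the chart monomial of exactly one term `h`
(with multiplicity one): `(φ̂ e)(u) = e(x_u) + e(x_h)`.
[cite: Hu2025, §4.2.1 Lem. 4.8 ‹chunk Lem. 4.7›, chunk p0022 l.74–106, p.48 L013–L032 (unrefereed preprint arXiv:2507.21400v1 under adjudication, D-0012/D-0089 — kernel support on OUR typed rendering of row 103 under explicit platform hypotheses; nothing of the source asserted)] -/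
theorem phiHat_apply_of_unique (mono : T → (σ →₀ ℕ)) (h : T) (u : σ) (hu : mono h = Finsupp.single u 1)
    (hu' : ∀ t : T, t ≠ h → u ∉ (mono t).support) (e : σ ⊕ T →₀ ℕ) :
    (e.sum fun i n => n • Sum.elim (fun s => Finsupp.single s 1) mono i) u = e (Sum.inl u) + e (Sum.inr h) := by
  classical
  rw [Finsupp.sum_apply, Finsupp.sum]
  -- split the sum over the support of `e` according to the three kinds of indices
  have key : ∀ i : σ ⊕ T, ((e i) • Sum.elim (fun s => Finsupp.single s 1) mono i) u =
      (if i = Sum.inl u then e i else 0) + (if i = Sum.inr h then e i else 0) := by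
    intro i
    rcases i with s | t
    · simp only [Sum.elim_inl, Finsupp.smul_apply, Finsupp.single_apply, smul_eq_mul, Sum.inl.injEq,
        reduceCtorEq, if_false, add_zero]
      by_cases hs : s = u
      · subst hs; simp
      · simp [hs]
    · simp only [Sum.elim_inr, Finsupp.smul_apply, smul_eq_mul, reduceCtorEq, if_false, zero_add, Sum.inr.injEq]
      by_cases ht : t = h
      · subst ht; rw [hu]; simp
      · have : (mono t) u = 0 := Finsupp.notMem_support_iff.mp (hu' t ht)
        rw [this, if_neg ht]; simp
  simp_rw [key]
  rw [Finset.sum_add_distrib, Finset.sum_ite_eq' , Finset.sum_ite_eq']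
  simp only [Finsupp.mem_support_iff, ne_eq, ite_not]
  split_ifs with h1 h2 h2 <;> simp_all

/-- The platform hypotheses make `Lem4_8` (generic rendering, file b) a THEOREM: (H0) `k` nontrivial; `hhead`: the leading
term of `F` is a term of `F`; (H1) for rank-one `F` the chart monomial of its leading term is one ϖ-variable `x_{u_F}`;
(H2) `u_F` occurs in the chart monomial of no other term («`x_(123,abc)` is the unique ϱ-variable whose `φ`-image is
divisible by `x_abc`», chunk p0022 l.92–93). Under these the printed proof (p0022 l.87–106) goes through verbatim.
[cite: Hu2025, §4.2.1 Lem. 4.8 ‹chunk Lem. 4.7›, chunk p0022 l.74–106, p.48 L013–L032 (unrefereed preprint arXiv:2507.21400v1 under adjudication, D-0012/D-0089 — kernel support on OUR typed rendering of row 103 under explicit platform hypotheses; nothing of the source asserted)] -/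
theorem Lem4_8_of_platform [DecidableEq 𝔗] [DecidableEq σ] [DecidableEq T] [Nontrivial k] (rel : T → 𝔗)
    (mono : T → (σ →₀ ℕ)) (rk : 𝔗 → ℕ) (head : 𝔗 → T) (u : 𝔗 → σ) (Φ : Set 𝔗)
    (hhead : ∀ F, rel (head F) = F)
    (H1 : ∀ F, rk F = 1 → mono (head F) = Finsupp.single (u F) 1)
    (H2 : ∀ F, rk F = 1 → ∀ t : T, t ≠ head F → u F ∉ (mono t).support) :
    Lem4_8 (k := k) rel mono rk head Φ := by
  classical
  intro F a a' hrk hne hmem hncf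
  set h := head F with hh
  set uF := u F with huF
  have hmono : mono h = Finsupp.single uF 1 := H1 F hrk
  have hmonoR : monoR mono h = Finsupp.single (Sum.inl uF : σ ⊕ T) 1 := by
    unfold monoR; rw [hmono, Finsupp.mapDomain_single]
  obtain ⟨hR, hH, hφ⟩ := hmem
  -- (★) from φ m = φ m′
  have haa : a ≠ a' := by
    intro e; apply hne; rw [e, sub_self]
  have hstar : a (Sum.inl uF) + a (Sum.inr h) = a' (Sum.inl uF) + a' (Sum.inr h) := by
    rw [map_sub, sub_eq_zero, varphi_monomial, varphi_monomial, monomial_eq_monomial_iff] at hφ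
    rcases hφ with ⟨he, -⟩ | ⟨h10, -⟩
    · have := DFunLike.congr_fun he uF
      rwa [phiHat_apply_of_unique mono h uF hmono (H2 F hrk), phiHat_apply_of_unique mono h uF hmono (H2 F hrk)]
        at this
    · exact absurd h10 one_ne_zero
  -- no common factor at the two relevant indices
  have ncf_h := hncf (Sum.inr h)
  have ncf_u := hncf (Sum.inl uF)
  -- single ≤ iff coordinate ≥ 1
  have hsingle_le : ∀ (i : σ ⊕ T) (e : σ ⊕ T →₀ ℕ), Finsupp.single i 1 ≤ e ↔ 1 ≤ e i := fun i e =>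
    Finsupp.single_le_iff.trans (by simp)
  refine ⟨⟨fun h1 => ?_, fun h1 => ?_⟩, fun hdiv => ?_⟩
  · -- 1a
    rw [hsingle_le] at h1
    rw [hmonoR, hsingle_le]
    rcases ncf_h with h0 | h0
    · omega
    · omega
  · -- 1b
    rw [hmonoR, hsingle_le] at h1
    rw [hsingle_le]
    rcases ncf_u with h0 | h0
    · omega
    · omega
  · -- 2: ℘-reducible + congruence
    -- `F ∈ Φ`: `x_h` occurs in `m − m′ ∈ R_Φ`
    have hsupp_a : a ∈ (monomial a (1 : k) - monomial a' 1 : ModelRing σ T k).support := by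
      rw [mem_support_iff, coeff_sub, coeff_monomial, coeff_monomial, if_pos rfl, if_neg (Ne.symm haa)]; simp
    have hsupp_a' : a' ∈ (monomial a (1 : k) - monomial a' 1 : ModelRing σ T k).support := by
      rw [mem_support_iff, coeff_sub, coeff_monomial, coeff_monomial, if_neg haa, if_pos rfl]; simp
    have hvars : ∀ (e : σ ⊕ T →₀ ℕ), e ∈ (monomial a (1 : k) - monomial a' 1 : ModelRing σ T k).support →
        ∀ t : T, e (Sum.inr t) ≠ 0 → rel t ∈ Φ := by
      intro e he t ht
      unfold RSub at hR
      rw [mem_supported] at hR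
      have : (Sum.inr t : σ ⊕ T) ∈ (↑((monomial a (1 : k) - monomial a' 1 : ModelRing σ T k).vars) : Set (σ ⊕ T)) := by
        rw [Finset.mem_coe, mem_vars_iff_mem_support]
        exact ⟨e, he, Finsupp.mem_support_iff.mpr ht⟩
      rcases hR this with ⟨s, hs⟩ | ⟨t'', ht'', hinj⟩
      · cases hs
      · cases hinj; exact ht''
    -- block-`F` weights of `a` and `a′` agree
    obtain ⟨d, hd⟩ := hH F
    have hwa : Finsupp.weight (blockWeight rel F) a = d := hd (mem_support_iff.mp hsupp_a)
    have hwa' : Finsupp.weight (blockWeight rel F) a' = d := hd (mem_support_iff.mp hsupp_a')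
    -- weight bookkeeping: a coordinate in the block bounds the weight below; all-zero block ⇒ weight 0
    have hle_weight : ∀ (e : σ ⊕ T →₀ ℕ) (t : T), rel t = F →
        e (Sum.inr t) ≤ Finsupp.weight (blockWeight rel F) e := by
      intro e t ht
      by_cases h0 : e (Sum.inr t) = 0
      · rw [h0]; exact Nat.zero_le _
      rw [Finsupp.weight_apply, Finsupp.sum]
      have := Finset.single_le_sum (f := fun i => e i • blockWeight rel F i) (s := e.support)
        (fun i _ => Nat.zero_le _) (Finsupp.mem_support_iff.mpr h0)
      simp only [blockWeight, Sum.elim_inr, ht, if_true, smul_eq_mul, mul_one] at this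
      exact this
    have hex : ∀ (e e' : σ ⊕ T →₀ ℕ), Finsupp.weight (blockWeight rel F) e = Finsupp.weight (blockWeight rel F) e' →
        1 ≤ e (Sum.inr h) → e' (Sum.inr h) = 0 → ∃ t' : T, rel t' = F ∧ t' ≠ h ∧ 1 ≤ e' (Sum.inr t') := by
      intro e e' hw h1 h0
      by_contra hcon
      have hcon' : ∀ t' : T, rel t' = F → t' ≠ h → e' (Sum.inr t') = 0 := by
        intro t' h1' h2'
        by_contra h3
        exact hcon ⟨t', h1', h2', by omega⟩
      have hzero : Finsupp.weight (blockWeight rel F) e' = 0 := by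
        rw [Finsupp.weight_apply, Finsupp.sum]
        apply Finset.sum_eq_zero
        intro i hi
        rcases i with s | t
        · simp [blockWeight]
        · by_cases ht : rel t = F
          · exfalso
            by_cases hth : t = h
            · subst hth; exact (Finsupp.mem_support_iff.mp hi) h0
            · exact (Finsupp.mem_support_iff.mp hi) (hcon' t ht hth)
          · simp [blockWeight, ht]
      have := hle_weight e h (hhead F)
      rw [hw, hzero] at this
      omega
    -- the ℘-binomial of two distinct terms of one block is nonzero (exponents differ at `x_{t₁}`)
    have hmonoR_inr : ∀ (t₁ t₂ : T), monoR mono t₁ (Sum.inr t₂ : σ ⊕ T) = 0 := fun t₁ t₂ =>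
      Finsupp.mapDomain_notin_range _ _ (by rintro ⟨s₀, hs₀⟩; cases hs₀)
    have hwp_ne : ∀ (t₁ t₂ : T), t₁ ≠ t₂ → wpBinomial (k := k) (σ := σ) mono t₁ t₂ ≠ 0 := by
      intro t₁ t₂ hne12
      rw [wpBinomial_eq, sub_ne_zero]
      intro heq
      rw [monomial_eq_monomial_iff] at heq
      rcases heq with ⟨he, -⟩ | ⟨h10, -⟩
      · have := DFunLike.congr_fun he (Sum.inr t₁)
        rw [Finsupp.add_apply, Finsupp.add_apply, hmonoR_inr, hmonoR_inr, Finsupp.single_eq_same,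
          Finsupp.single_eq_of_ne (fun e => hne12 (Sum.inr_injective e))] at this
        simp at this
      · exact one_ne_zero h10
    -- pointwise test for `e_i + e_j ≤ e` at two DIFFERENT indices
    have hpair_le : ∀ (i j : σ ⊕ T) (e : σ ⊕ T →₀ ℕ), i ≠ j → 1 ≤ e i → 1 ≤ e j →
        Finsupp.single i 1 + Finsupp.single j 1 ≤ e := by
      intro i j e hij hi hj
      refine Finsupp.le_def.mpr fun l => ?_
      rw [Finsupp.add_apply, Finsupp.single_apply, Finsupp.single_apply]
      by_cases h1 : i = l
      · subst h1; rw [if_pos rfl, if_neg (Ne.symm hij)]; omega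
      · rw [if_neg h1]
        by_cases h2 : j = l
        · subst h2; rw [if_pos rfl]; omega
        · rw [if_neg h2]; exact Nat.zero_le _
    -- `x̄_h = x_{u_F}` in `R`
    have hbar_h : (toModel (T := T) (img (k := k) mono h) : ModelRing σ T k) = X (Sum.inl uF) := by
      rw [toModel_img, hmonoR, X]
    rcases hdiv with h1 | h1
    · -- CASE `x_h ∣ m`
      rw [hsingle_le] at h1
      have ha'h : a' (Sum.inr h) = 0 := by rcases ncf_h with h0 | h0 <;> omega
      have ha'u : 1 ≤ a' (Sum.inl uF) := by rcases ncf_h with h0 | h0 <;> omega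
      obtain ⟨t', ht'F, ht'h, ht'⟩ := hex a a' (hwa.trans hwa'.symm) h1 ha'h
      have hFΦ : rel h ∈ Φ := hvars a hsupp_a h (by omega)
      refine ⟨⟨h, t', by rw [hhead F, ht'F], Ne.symm ht'h, hFΦ, hwp_ne h t' (Ne.symm ht'h), Or.inr ⟨?_, ?_⟩⟩, ?_⟩
      · rw [hsingle_le]; exact h1
      · rw [hmonoR]
        exact hpair_le _ _ a' (by simp) ha'u ht'
      · -- congruence: `(m − m′) − x_h (n − n′) = x^r · (x̄_{t′} x_h − x̄_h x_{t′})`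
        obtain ⟨r₀, hr₀⟩ := le_iff_exists_add.mp ((hsingle_le (Sum.inr h) a).mpr h1)
        obtain ⟨r, hr⟩ := le_iff_exists_add.mp (hpair_le (Sum.inl uF) (Sum.inr t') a' (by simp) ha'u ht')
        refine ⟨monomial r₀ 1, toModel (T := T) (img (k := k) mono t') * monomial r 1, ?_⟩
        have hma : (monomial a (1 : k) : ModelRing σ T k) = rhoVar (k := k) (σ := σ) h * monomial r₀ 1 := by
          unfold rhoVar; rw [X, monomial_mul, one_mul, ← hr₀]
        have hma' : (monomial a' (1 : k) : ModelRing σ T k) =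
            toModel (T := T) (img (k := k) mono h) * rhoVar (k := k) (σ := σ) t' * monomial r 1 := by
          unfold rhoVar; rw [hbar_h, X, X, monomial_mul, monomial_mul, one_mul, one_mul, ← hr]
        have hcalc : (monomial a (1 : k) - monomial a' 1 : ModelRing σ T k) -
            rhoVar (k := k) (σ := σ) h * (monomial r₀ 1 - toModel (T := T) (img (k := k) mono t') * monomial r 1) =
            monomial r 1 * wpBinomial (k := k) (σ := σ) mono h t' := by
          rw [hma, hma']; unfold wpBinomial; ring
        rw [hcalc]
        exact Ideal.mul_mem_left _ _ (Ideal.subset_span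
          ⟨h, t', by rw [hhead F, ht'F], Ne.symm ht'h, hFΦ, rfl, hwp_ne h t' (Ne.symm ht'h)⟩)
    · -- CASE `x̄_h = x_{u_F} ∣ m`
      rw [hmonoR, hsingle_le] at h1
      have ha'u : a' (Sum.inl uF) = 0 := by rcases ncf_u with h0 | h0 <;> omega
      have ha'h : 1 ≤ a' (Sum.inr h) := by omega
      have hah : a (Sum.inr h) = 0 := by rcases ncf_h with h0 | h0 <;> omega
      obtain ⟨t', ht'F, ht'h, ht'⟩ := hex a' a (hwa'.trans hwa.symm) ha'h hah
      have hFΦ : rel h ∈ Φ := hvars a' hsupp_a' h (by omega)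
      refine ⟨⟨t', h, by rw [hhead F, ht'F], ht'h, by rw [ht'F, ← hhead F]; exact hFΦ, hwp_ne t' h ht'h,
        Or.inl ⟨?_, ?_⟩⟩, ?_⟩
      · rw [hmonoR]
        exact hpair_le _ _ a (by simp) h1 ht'
      · rw [hsingle_le]; exact ha'h
      · obtain ⟨r, hr⟩ := le_iff_exists_add.mp (hpair_le (Sum.inl uF) (Sum.inr t') a (by simp) h1 ht')
        obtain ⟨r₀, hr₀⟩ := le_iff_exists_add.mp ((hsingle_le (Sum.inr h) a').mpr ha'h)
        refine ⟨toModel (T := T) (img (k := k) mono t') * monomial r 1, monomial r₀ 1, ?_⟩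
        have hma : (monomial a (1 : k) : ModelRing σ T k) =
            toModel (T := T) (img (k := k) mono h) * rhoVar (k := k) (σ := σ) t' * monomial r 1 := by
          unfold rhoVar; rw [hbar_h, X, X, monomial_mul, monomial_mul, one_mul, one_mul, ← hr]
        have hma' : (monomial a' (1 : k) : ModelRing σ T k) = rhoVar (k := k) (σ := σ) h * monomial r₀ 1 := by
          unfold rhoVar; rw [X, monomial_mul, one_mul, ← hr₀]
        have hcalc : (monomial a (1 : k) - monomial a' 1 : ModelRing σ T k) -
            rhoVar (k := k) (σ := σ) h * (toModel (T := T) (img (k := k) mono t') * monomial r 1 - monomial r₀ 1) =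
            monomial r 1 * wpBinomial (k := k) (σ := σ) mono t' h := by
          rw [hma, hma']; unfold wpBinomial; ring
        rw [hcalc]
        exact Ideal.mul_mem_left _ _ (Ideal.subset_span
          ⟨t', h, by rw [hhead F, ht'F], ht'h, by rw [ht'F, ← hhead F]; exact hFΦ, rfl, hwp_ne t' h ht'h⟩)

/-- **`Lem4_8_ours` (file c) — DISCHARGED for every commutative ring `k`** (trivial `k`: the nonzero hypothesis is absurd;
nontrivial `k`: `Lem4_8_of_platform`).
[cite: Hu2025, §4.2.1 Lem. 4.8 ‹chunk Lem. 4.7›, chunk p0022 l.74–106, p.48 L013–L032 (unrefereed preprint arXiv:2507.21400v1 under adjudication, D-0012/D-0089 — kernel support on OUR typed rendering of row 103 under explicit platform hypotheses; nothing of the source asserted)] -/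
theorem Lem4_8_ours_holds : ∀ {k : Type u} [CommRing k] {σ : Type v} {T : Type w} {𝔗 : Type x} [DecidableEq 𝔗] [DecidableEq σ] [DecidableEq T]
    (rel : T → 𝔗) (mono : T → (σ →₀ ℕ)) (rk : 𝔗 → ℕ) (head : 𝔗 → T) (Φ : Set 𝔗),
    Lem4_8_ours (k := k) rel mono rk head Φ := by
  intro k _ σ T 𝔗 _ _ _ rel mono rk head Φ u hhead H1 H2
  rcases subsingleton_or_nontrivial k with hk | hk
  · intro F a a' _ hne
    exact absurd (Subsingleton.elim _ _) hne
  · exact Lem4_8_of_platform rel mono rk head u Φ hhead H1 H2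

end Literature.AlgebraicGeometry.Hu2025.Statements.S04ModelV

end
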